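import Literature.NumberTheory.LFunctions.DirichletLTruncationPacked
import Literature.NumberTheory.LFunctions.FeketePolyaKernelSignTablesWide
import HarnessLib

/-!
# Packed truncation certificate data for the conductor `14693` (frame: coverage of [1/2,1] by the 164 cells and the U-walk)

Kernel evaluation (`decide +kernel`) of one piece of the packed truncation certificate (Chua's ALGO 1, `K = 24` periods,
`G = 181`, `E = 2^13`, `P = 40`, digit width `72`; 164 graded cells: `h = 1/8192` on `[1/2, 0.506]`, `1/2048` to `0.545`,
`1/512` to `0.58`, `1/128` to `0.65`, `1/32` to `0.8`, `1/8` to `1`) for the even primitive quadratic character of conductor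
`14693 = 7·2099` (`B⁻ = 6812`); consumed by the soundness theorem of `LTruncationPacked.certTcells` / `certTframe`.
[cite: Chua2005RealZeros, §2.2 ALGO 1]
-/

namespace Literature.NumberTheory.LFunctions

namespace LTruncationPacked

open FeketePolyaKernel

set_option maxHeartbeats 0 in
/-- frame: coverage of [1/2,1] by the 164 cells and the U-walk: the check passes. [cite: Chua2005RealZeros, §2.2 ALGO 1] -/
theorem certTframe_14693 :
    certTframe 72 15 13 14693 6812
      [(4096, 1), (4097, 1), (4098, 1), (4099, 1), (4100, 1), (4101, 1), (4102, 1), (4103, 1), (4104, 1), (4105, 1), (4106, 1), (4107, 1), (4108, 1), (4109, 1), (4110, 1), (4111, 1), (4112, 1), (4113, 1), (4114, 1), (4115, 1), (4116, 1), (4117, 1), (4118, 1), (4119, 1), (4120, 1), (4121, 1), (4122, 1), (4123, 1), (4124, 1), (4125, 1), (4126, 1), (4127, 1), (4128, 1), (4129, 1), (4130, 1), (4131, 1), (4132, 1), (4133, 1), (4134, 1), (4135, 1), (4136, 1), (4137, 1), (4138, 1), (4139, 1), (4140, 1), (4141, 1), (4142, 1), (4143, 1), (4144, 1), (4145, 1),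 (4146, 4), (4150, 4), (4154, 4), (4158, 4), (4162, 4), (4166, 4), (4170, 4), (4174, 4), (4178, 4), (4182, 4), (4186, 4), (4190, 4), (4194, 4), (4198, 4), (4202, 4), (4206, 4), (4210, 4), (4214, 4), (4218, 4), (4222, 4), (4226, 4), (4230, 4), (4234, 4), (4238, 4), (4242, 4), (4246, 4), (4250, 4), (4254, 4), (4258, 4), (4262, 4), (4266, 4), (4270, 4), (4274, 4), (4278, 4), (4282, 4), (4286, 4), (4290, 4), (4294, 4), (4298, 4), (4302, 4), (4306, 4), (4310, 4), (4314, 4), (4318, 4), (4322, 4), (4326, 4), (4330, 4), (4334, 4), (4338, 4), (4342, 4), (4346, 4), (4350, 4), (4354, 4), (4358, 4), (4362, 4), (4366, 4), (4370, 4), (4374, 4), (4378, 4), (4382, 4), (4386, 4), (4390, 4), (4394, 4), (4398, 4), (4402, 4), (4406, 4), (4410, 4), (4414, 4), (4418, 4), (4422, 4), (4426, 4), (4430, 4), (4434, 4), (4438, 4), (4442, 4), (4446, 4), (4450, 4), (4454, 4), (4458, 4), (4462, 4), (4466, 16), (4482, 16), (4498, 16), (4514, 16), (4530, 16), (4546,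 16), (4562, 16), (4578, 16), (4594, 16), (4610, 16), (4626, 16), (4642, 16), (4658, 16), (4674, 16), (4690, 16), (4706, 16), (4722, 16), (4738, 16), (4754, 64), (4818, 64), (4882, 64), (4946, 64), (5010, 64), (5074, 64), (5138, 64), (5202, 64), (5266, 64), (5330, 256), (5586, 256), (5842, 256), (6098, 256), (6354, 256), (6610, 1024), (7634, 1024)]
      (plainTabsC 0 72 47 [7, 2099] 14693) = true := by
  decide +kernel

end LTruncationPacked

end Literature.NumberTheory.LFunctions
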